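import Summits.AtomisticToContinuum.Crystallization.Theorems.FrustratedLawDichotomyStrainedPatchHomEntryQuick
import Summits.AtomisticToContinuum.Crystallization.Theorems.FrustratedLawDichotomyStrainedPatchHomEntryTreeCert

/-!
# A HOLE in the fcc verdict of record and its repair: the SHORT-VECTOR prune `shortOut`, the verdict `entryLeafOK7Q`, certificate v9

decomp-a2c hand-1 g25 (crux `AperiodicFrustratedLawGap`, stmt-AtomisticToContinuum-27623; critic rows 965/977/981).

THE HOLE (measured, plan-driver v2 re-smoke of gate32's address `000010100100` with fuel 200, farm 2026-09-01T22:0xZ, reproduced byte-identically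
by the core-only port): the strict search with `entryLeafOK6Q muRec` (= `entryLeafOK6RBKP muRec`, `…HomEntryQuick.entryLeafOK6Q_eq`) dives to depth
212 and FAILS on the box of half-width `2⁻³⁸…2⁻³⁷` at (entries / `SC`)
`u₀₀ = 7/8, u₀₁ = 0⁻, u₀₂ = 0⁺, u₁₁ ≈ u₂₂ ≈ 0.81137, u₁₂ ≈ −0.16407` — a self-adjoint `U` whose three columns of `U − 1` have norms `1/8, 1/4, 1/4`
(so the column prune `colOutOK` cannot fire: it needs `> 1/4` on the whole box) but whose operator norm `‖U − 1‖ = 0.3527 > 1/4` puts it OUTSIDE the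
admissible ball of `IsHomBall`; there the nearest-neighbour images `U f_{(±1,0,0)}` have `‖U f‖² = 0.41900 < 1/2`, BELOW the first row `t = 1/2` of every
q-table (`qTable`, `qTableK1…4`), so `tableLeafOK / tableLeafOKK / tableLeafOKP` fail by RANGE (`Acc.ok = false`, not by energy: `lhs ≤ rhs` holds),
the fits fail (far from `SO(3)`), `radOK` fails (the eight second-nearest images sit at ratio `1.3158`, just outside the radial window `(9/8, 13/10)`),
and `signOut/domOut` fail (the box touches `u₀₁ = 0`).  Every box around that point fails the same way, so NO fuel suffices: the v1 smoke's `NO TREE`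
was fuel starvation elsewhere, but this address is a genuine hole of the verdict — the (H) fcc certificate cannot be completed with `entryLeafOK6RBKP`.

THE REPAIR uses only the hypothesis the column prune already uses (`‖U − 1‖ ≤ 1/4`): every non-zero lattice image then has norm `≥ 3/4`
(`…HomRelief.norm_latPt_fcc_ge`), so a box on which some first-shell image is SHORTER than `3/4` — `16 · q_b.hi < 9 · SC` for some `b ∈ K12`,
`q_b = qformFI (gramT c w) b ∋ SC · ‖latPt U fccVec b‖²` (`…HomEntryFitKit.mem_normSq_latPt`) — contains no admissible `U`: a vacuous leaf.  Since the
tables need `q ≥ 1/2` and the prune fires below `9/16`, the two overlap on `[1/2, 9/16)`.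

* §1 `shortOut` + ★ `false_of_shortOut`;
* §2 ★ `entryLeafOK7Q μ c w := entryLeafOK6Q μ c w || shortOut (c ∘ symIdx) (w ∘ symIdx)` (record verdict first, the new prune LAST — it only fires far
  outside the admissible ball), ★ `entryLeafOK7Q_sound` (the domain-relativised `hver` shape of `…HomEntrySign.fccHalf_of_entryTreeDom`), monotonicity
  `entryLeafOK7Q_of_6Q` / `treeOK_7Q_of_6Q` / `exists_tree_7Q_of_6Q` (every landed `6Q`/`6RBKP` shard certificate is a `7Q` certificate);
* §3 ★★ `fccHalf_of_entryTree7Q`, ★★★ `homFloor_of_entryTrees7Q_HVK`, ★★★ `homFloor_625_of_entryTrees7Q_HVK` — CERTIFICATE v9: the fcc root fact is now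
  `∃ t, treeOK (entryLeafOK7Q muRec) t rootC rootW = true`; the hcp side (`entryLeafOKHVK`, hand-2) is unchanged (hand-2: check the analogous region
  `‖cols‖ ≤ 1/4 < ‖U − 1‖` of the hcp cube);
* §4 kernel regression test: on the measured FAIL box `entryLeafOK6Q muRec = false` and `entryLeafOK7Q muRec = true`.

Computable; 0 sorry; standard axioms; no instances / notation / `#eval`.  `--supports stmt-AtomisticToContinuum-27623`.
-/

namespace Summit.AtomisticToContinuum.Crystallization.Theorems.FrustratedLawDichotomyStrainedPatchHomEntryShort

open scoped BigOperators RealInnerProductSpace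
open Literature.Analysis.ValidatedNumerics.Numerics
open Summit.AtomisticToContinuum.Crystallization.Theorems.ChargedEnergyGapNegative (E3)
open Summit.AtomisticToContinuum.Crystallization.Theorems.FrustratedLawDichotomySchurCut (effPot w₄₅ ω₄)
open Summit.AtomisticToContinuum.Crystallization.Theorems.FrustratedLawDichotomyAveragingRuleTightFree (TightNearCap BadNearCap)
open Summit.AtomisticToContinuum.Crystallization.Theorems.FrustratedLawDichotomyExemptAbsorption (ExemptNear)
open Summit.AtomisticToContinuum.Crystallization.Theorems.FrustratedLawDichotomyStrainedPatchHomSplit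
open Summit.AtomisticToContinuum.Crystallization.Theorems.FrustratedLawDichotomyStrainedPatchHomPrunedPolar (homFloor_of_prunedBoxSums_selfAdjoint)
open Summit.AtomisticToContinuum.Crystallization.Theorems.FrustratedLawDichotomyStrainedPatchHomRelief (norm_latPt_fcc_ge)
open Summit.AtomisticToContinuum.Crystallization.Theorems.FrustratedLawDichotomyStrainedPatchHomCertTree (CertTree treeOK)
open Summit.AtomisticToContinuum.Crystallization.Theorems.FrustratedLawDichotomyStrainedPatchHomEntryGram (rootC rootW)
open Summit.AtomisticToContinuum.Crystallization.Theorems.FrustratedLawDichotomyStrainedPatchHomEntryGramHcp (rootCH rootWH)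
open Summit.AtomisticToContinuum.Crystallization.Theorems.FrustratedLawDichotomyStrainedPatchHomEntryFitKit (K12 qformFI gramT mem_normSq_latPt)
open Summit.AtomisticToContinuum.Crystallization.Theorems.FrustratedLawDichotomyStrainedPatchHomEntrySix (symIdx hbox_sym)
open Summit.AtomisticToContinuum.Crystallization.Theorems.FrustratedLawDichotomyStrainedPatchHomEntryTable (muRec muRec_ok)
open Summit.AtomisticToContinuum.Crystallization.Theorems.FrustratedLawDichotomyStrainedPatchHomEntrySign (fccHalf_of_entryTreeDom)
open Summit.AtomisticToContinuum.Crystallization.Theorems.FrustratedLawDichotomyStrainedPatchHomEntryTableP (entryLeafOK6RBKP entryLeafOK6RBKP_sound)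
open Summit.AtomisticToContinuum.Crystallization.Theorems.FrustratedLawDichotomyStrainedPatchHomEntryQuick (entryLeafOK6Q entryLeafOK6Q_apply treeOK_of_imp)
open Summit.AtomisticToContinuum.Crystallization.Theorems.FrustratedLawDichotomyStrainedPatchHomLeafTableCheckHcpV (entryLeafOKHVK)
open Summit.AtomisticToContinuum.Crystallization.Theorems.FrustratedLawDichotomyStrainedPatchHomEntryTreeCert (hcpHalf_of_entryTreeHVK)
open Literature.Barriers.AtomisticToContinuum.FlatleyTheil2015 (fccVec)

/-! ## §1. The short-vector prune -/

/-- ★ **SHORT-VECTOR PRUNE**: some first-shell image is shorter than `3/4` on the whole entry box — `16 · q_b.hi < 9 · SC` for some kissing label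
`b ∈ K12`, `q_b = qformFI (gramT c w) b ∋ SC·‖latPt U fccVec b‖²`.  Impossible under `‖U − 1‖ ≤ 1/4` (then every non-zero lattice image has norm
`≥ 3/4`): a vacuous leaf. -/
def shortOut (c w : Fin 3 × Fin 3 → ℤ) : Bool := K12.any fun b => decide (16 * (qformFI (gramT c w) b).hi < 9 * (SC : ℤ))

/-- The kissing labels are non-zero. [formal bookkeeping] -/
theorem ne_zero_of_mem_K12 {b : Fin 3 → ℤ} (hb : b ∈ K12) : b ≠ 0 := by
  simp only [K12, List.mem_cons, List.mem_nil_iff, or_false] at hb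
  rcases hb with rfl | rfl | rfl | rfl | rfl | rfl | rfl | rfl | rfl | rfl | rfl | rfl <;> decide

/-- ★ Soundness of the short-vector prune: no `U` with `‖U − 1‖ ≤ 1/4` has its entries in such a box. [folklore] -/
theorem false_of_shortOut {c w : Fin 3 × Fin 3 → ℤ} (h : shortOut c w = true) (U : E3 →L[ℝ] E3) (hU : ‖U - 1‖ ≤ 1 / 4)
    (hbox : ∀ ab : Fin 3 × Fin 3, |(U (EuclideanSpace.single ab.2 (1 : ℝ))) ab.1 - (c ab : ℝ) / SC| ≤ (w ab : ℝ) / SC) : False := by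
  simp only [shortOut, List.any_eq_true, decide_eq_true_eq] at h
  obtain ⟨b, hb, hlt⟩ := h
  have hS : (0 : ℝ) < SC := SC_pos
  have hhi : ‖latPt U fccVec b‖ ^ 2 * SC ≤ ((qformFI (gramT c w) b).hi : ℝ) := (mem_normSq_latPt U hbox b).2
  have hge : 3 / 4 ≤ ‖latPt U fccVec b‖ := norm_latPt_fcc_ge hU (ne_zero_of_mem_K12 hb)
  have hsq : (3 / 4 : ℝ) ^ 2 ≤ ‖latPt U fccVec b‖ ^ 2 := pow_le_pow_left₀ (by norm_num) hge 2
  have hsqS : (3 / 4 : ℝ) ^ 2 * SC ≤ ‖latPt U fccVec b‖ ^ 2 * SC := mul_le_mul_of_nonneg_right hsq hS.le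
  have hlt' : (16 : ℝ) * ((qformFI (gramT c w) b).hi : ℝ) < 9 * (SC : ℝ) := by exact_mod_cast hlt
  nlinarith

/-! ## §2. The repaired verdict and its soundness -/

/-- ★ **THE REPAIRED fcc VERDICT** (cheap-first): the verdict of record `entryLeafOK6Q μ` (= `entryLeafOK6RBKP μ`), ELSE the short-vector prune on the
mirror-symmetrised box (it only fires far outside the admissible ball, so it is tried last). -/
def entryLeafOK7Q (μ : ℤ) (c w : Fin 3 × Fin 3 → ℤ) : Bool := entryLeafOK6Q μ c w || shortOut (c ∘ symIdx) (w ∘ symIdx)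

/-- ★ **Soundness of `entryLeafOK7Q`** in the domain-relativised `hver` shape of `…HomEntrySign.fccHalf_of_entryTreeDom` (verbatim the shape of
`…HomEntryTableP.entryLeafOK6RBKP_sound`). [folklore] -/
theorem entryLeafOK7Q_sound {μ : ℤ} {c w : Fin 3 × Fin 3 → ℤ} (h : entryLeafOK7Q μ c w = true) (U : E3 →L[ℝ] E3)
    (hsa : ∀ v v' : E3, ⟪U v, v'⟫ = ⟪v, U v'⟫) (hU : ‖U - 1‖ ≤ 1 / 4)
    (hbox : ∀ ab : Fin 3 × Fin 3, |(U (EuclideanSpace.single ab.2 (1 : ℝ))) ab.1 - (c ab : ℝ) / SC| ≤ (w ab : ℝ) / SC)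
    (h1 : (U (EuclideanSpace.single 1 (1 : ℝ))) 1 ≤ (U (EuclideanSpace.single 0 (1 : ℝ))) 0)
    (h2 : (U (EuclideanSpace.single 2 (1 : ℝ))) 2 ≤ (U (EuclideanSpace.single 1 (1 : ℝ))) 1)
    (h01 : 0 ≤ (U (EuclideanSpace.single 1 (1 : ℝ))) 0) (h02 : 0 ≤ (U (EuclideanSpace.single 2 (1 : ℝ))) 0) :
    (∀ (M : ℕ) (z : Fin M → E3) (c : Fin M), Function.Injective z →
        Set.range z = {x : E3 | dist x (z c) ≤ 133 / 10 ∧ ∃ a : Fin 3 → ℤ, x = z c + latPt U fccVec a} →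
        TightNearCap (9 / 5) (3 / 2) z c ∨ ExemptNear (9 / 5) ExRec z c ∨ BadNearCap (9 / 5) (3 / 2) z c) ∨
      (μ : ℝ) / SC ≤ ∑ b ∈ (Fintype.piFinset fun _ : Fin 3 => Finset.Icc (-7 : ℤ) 7).filter (fun b => b ≠ 0),
        effPot w₄₅ ω₄ (3 / 400) ‖latPt U fccVec b‖ := by
  rw [entryLeafOK7Q, Bool.or_eq_true] at h
  rcases h with h | h
  · rw [entryLeafOK6Q_apply] at h
    exact entryLeafOK6RBKP_sound h U hsa hU hbox h1 h2 h01 h02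
  · exact (false_of_shortOut h U hU (hbox_sym hsa hbox)).elim

/-- Monotonicity: the verdict of record implies the repaired verdict pointwise. [formal bookkeeping] -/
theorem entryLeafOK7Q_of_6Q (μ : ℤ) (c w : Fin 3 × Fin 3 → ℤ) (h : entryLeafOK6Q μ c w = true) : entryLeafOK7Q μ c w = true := by
  rw [entryLeafOK7Q, h, Bool.true_or]

/-- … hence every `6Q` certificate tree is a `7Q` certificate tree (landed shards keep their value). [formal bookkeeping] -/
theorem treeOK_7Q_of_6Q (μ : ℤ) (t : CertTree (Fin 3 × Fin 3)) (c w : Fin 3 × Fin 3 → ℤ) (h : treeOK (entryLeafOK6Q μ) t c w = true) :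
    treeOK (entryLeafOK7Q μ) t c w = true :=
  treeOK_of_imp (entryLeafOK7Q_of_6Q μ) t c w h

/-- … and every `6Q` ∃-tree fact is a `7Q` ∃-tree fact. [formal bookkeeping] -/
theorem exists_tree_7Q_of_6Q {μ : ℤ} {c w : Fin 3 × Fin 3 → ℤ} (h : ∃ t : CertTree (Fin 3 × Fin 3), treeOK (entryLeafOK6Q μ) t c w = true) :
    ∃ t : CertTree (Fin 3 × Fin 3), treeOK (entryLeafOK7Q μ) t c w = true := by
  obtain ⟨t, ht⟩ := h
  exact ⟨t, treeOK_7Q_of_6Q μ t c w ht⟩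

/-! ## §3. Certificate v9: the fcc root fact with the repaired verdict -/

/-- ★★ The fcc half from ONE certificate TREE with the repaired verdict `entryLeafOK7Q μ` on the root cube. [folklore] -/
theorem fccHalf_of_entryTree7Q {m : ℝ} {μ : ℤ} (hμ : 2 * (m + (-(7175 / 10000) + 3 / 400)) * SC ≤ μ) {t : CertTree (Fin 3 × Fin 3)}
    (h : treeOK (entryLeafOK7Q μ) t rootC rootW = true) :
    ∀ U : E3 →L[ℝ] E3, (∀ v w : E3, inner ℝ (U v) w = inner ℝ v (U w)) → (∀ w : E3, 0 ≤ inner ℝ w (U w)) → ‖U - 1‖ ≤ 1 / 4 →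
      (∀ (M : ℕ) (z : Fin M → E3) (c : Fin M), Function.Injective z →
          Set.range z = {x : E3 | dist x (z c) ≤ 133 / 10 ∧ ∃ a : Fin 3 → ℤ, x = z c + latPt U fccVec a} →
          TightNearCap (9 / 5) (3 / 2) z c ∨ ExemptNear (9 / 5) ExRec z c ∨ BadNearCap (9 / 5) (3 / 2) z c) ∨
      m ≤ (∑ b ∈ (Fintype.piFinset fun _ : Fin 3 => Finset.Icc (-7 : ℤ) 7).filter (fun b => b ≠ 0),
        effPot w₄₅ ω₄ (3 / 400) ‖latPt U fccVec b‖) / 2 - (-(7175 / 10000) + 3 / 400) :=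
  fccHalf_of_entryTreeDom hμ (entryLeafOK7Q μ) (fun _ _ hv U hsa hU hbox h1 h2 h01 h02 => entryLeafOK7Q_sound hv U hsa hU hbox h1 h2 h01 h02) h

/-- ★★★ **`(H) HomFloor m` FROM TWO ∃-TREE FACTS, repaired fcc verdict** (`entryLeafOK7Q μ`; hcp `entryLeafOKHVK μ` unchanged); every `m`, `μ` with
`2 (m + e_W) SC ≤ μ`. [folklore] -/
theorem homFloor_of_entryTrees7Q_HVK {m : ℝ} {μ : ℤ} (hμ : 2 * (m + (-(7175 / 10000) + 3 / 400)) * SC ≤ μ)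
    (hF : ∃ t : CertTree (Fin 3 × Fin 3), treeOK (entryLeafOK7Q μ) t rootC rootW = true)
    (hH : ∃ t : CertTree ((Fin 3 × Fin 3) ⊕ Fin 3), treeOK (entryLeafOKHVK μ) t rootCH rootWH = true) : HomFloor m := by
  obtain ⟨tF, htF⟩ := hF
  obtain ⟨tH, htH⟩ := hH
  exact homFloor_of_prunedBoxSums_selfAdjoint (fccHalf_of_entryTree7Q hμ htF) (hcpHalf_of_entryTreeHVK hμ htH)

/-- ★★★ **`(H) HomFloor (1/625)`, CERTIFICATE v9**: the fcc root ∃-tree fact for the REPAIRED verdict at `μ = muRec` and the hcp root ∃-tree fact give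
`HomFloor (1/625)`. [folklore] -/
theorem homFloor_625_of_entryTrees7Q_HVK
    (hF : ∃ t : CertTree (Fin 3 × Fin 3), treeOK (entryLeafOK7Q muRec) t rootC rootW = true)
    (hH : ∃ t : CertTree ((Fin 3 × Fin 3) ⊕ Fin 3), treeOK (entryLeafOKHVK muRec) t rootCH rootWH = true) : HomFloor (1 / 625) :=
  homFloor_of_entryTrees7Q_HVK muRec_ok hF hH

/-! ## §4. Kernel regression test on the measured hole -/

/-- The FAIL box of the plan-driver v2 re-smoke (address `000010100100`, depth 212): centre. -/
def holeC : Fin 3 × Fin 3 → ℤ := fun ab =>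
  if ab = (0, 0) then 246290604622848 else if ab = (0, 1) then -2048 else if ab = (0, 2) then 2048
  else if ab = (1, 1) then 228380565765120 else if ab = (1, 2) then -46181637949440 else if ab = (2, 2) then 228380565764096 else 0

/-- … and half-widths (the three lower-triangle coordinates carry the root half-width; they are read from their mirrors). -/
def holeW : Fin 3 × Fin 3 → ℤ := fun ab =>
  if ab = (0, 0) then 1024 else if ab = (0, 1) then 2048 else if ab = (0, 2) then 2048
  else if ab = (1, 1) then 1024 else if ab = (1, 2) then 2048 else if ab = (2, 2) then 2048 else 70368744177664

/-- On the measured hole the short-vector prune fires (kernel evaluation). -/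
example : shortOut (holeC ∘ symIdx) (holeW ∘ symIdx) = true := by decide +kernel

end Summit.AtomisticToContinuum.Crystallization.Theorems.FrustratedLawDichotomyStrainedPatchHomEntryShort
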